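import Literature.AlgebraicGeometry.Motives.AbelianVarietyWeilPairingAlternating
import HarnessLib

/-!
# Functoriality of the level Weil pairing under homomorphisms: `ē_N^{f^*Θ}(P, Q) = ē_N^Θ(f P, f Q)`
# (Lang VII §2; Mumford §20 (3); Milne 1986 §16)

Layer `Literature/AlgebraicGeometry/Motives`, namespace `Literature.AlgebraicGeometry.Motives.AbelianVariety`.
KERNEL ONLY: theorems; no definition, no named fact, no `sorry`.

Let `f : A → B` be a DOMINANT homomorphism of abelian varieties over a field `K` (an isogeny, or any
surjective homomorphism), `Θ` a Cartier divisor on `B` and `N` a level with `[N]_A`, `[N]_B` dominant.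
For `N`-torsion points `P, Q ∈ A[N](K)` the level-`N` Weil pairing of the tree
(`Motives/AbelianVarietyWeilPairingLevel`: `ē_N^Θ(P, Q) = e_N(P, t_Q^* Θ − Θ) = t_P^♯ g_Q / g_Q`) satisfies

  **`ē_N^{f^*Θ}(P, Q) = ē_N^Θ(f P, f Q)`**   (`weilPairingLevel_pullback`, `weilPairingLevel_pullback_eq`).

This is Mumford, *Abelian Varieties*, §20, property (3) of `e_n` (p. 186: «if `f : X → Y` is a
homomorphism, then `e_n(f(x), ŷ) = e_n(x, f̂(ŷ))`», read on `ē^L(x, y) = e_n(x, φ_L y)` with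
`φ_{f^*L} = f̂ ∘ φ_L ∘ f`), Lang, *Abelian Varieties*, VII §2, Prop. 2 (iii) / Thm. 5 (functoriality of
`e_n(a, X)` under homomorphisms: `e_n(a, α⁻¹(Y)) = e_n(α a, Y)`), Milne 1986, §16 (`e^{f^*λ}`).

Proof (transport of structure along `f`, the pattern of `Motives/AbelianVarietyWeilPairingGalois`):
* `toSchemeHom_comp_zsmul` — `f` commutes with `[N]` (`f ≫ [N]_B = [N]_A ≫ f`, preadditivity);
* `translation_left_comp_toSchemeHom` — **`t_P ≫ f = f ≫ t_{f P}`** (`f` is a homomorphism of group schemes);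
* `map_mem_torsionPoints` — `f(A[N](K)) ⊆ B[N](K)`;
* `weilDiv_pullback_sameDivisor` — **`D_Q(f^*Θ) = f^*(D_{fQ}(Θ))`** as divisors:
  `t_Q^* f^* Θ − f^* Θ = (t_Q ≫ f)^* Θ − f^*Θ = (f ≫ t_{fQ})^* Θ − f^* Θ = f^*(t_{fQ}^* Θ − Θ)`;
* `IsTrivializer.comp_hom` — if `g` trivializes `[N]_B^* E` then `f^♯ g` trivializes `[N]_A^* f^* E`;
* hence `ē^{f^*Θ}(P, Q) = t_P^♯ f^♯ g_{fQ} / f^♯ g_{fQ} = f^♯ (t_{fP}^♯ g_{fQ} / g_{fQ}) = f^♯ ē^Θ(fP, fQ) =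
  ē^Θ(fP, fQ)` (`f^♯` fixes constants).

Use (cell `hodgecm-mathlib`, row II-1 `shimura1998_thm18_6` v2, stub S5 `polarisationTransport` in its
ℓ-adic form, B-p20 PREP-II1-S5 (W1)): with `κ : A → A^σ`, `κ ∘ ξ = ξ* ∘ id`, the Weil pairings of `X^σ`
at the `ξ*`-images are those of `κ^* X^σ` at the `ξ`-images; and `ι(b)^* X` for units `b`.

## References
* [MumfordAV1970] D. Mumford, *Abelian Varieties* (1970), §20, pp. 183–186, property (3) of `e_n`.
* [Lang1983AbelianVarieties] S. Lang, *Abelian Varieties*, Ch. VII §2, Props. 2–3, Thm. 5 (PDF pp. 138–142).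
* [Milne1986AbelianVarieties] J. S. Milne, *Abelian varieties*, in Cornell–Silverman (1986), §16, pp. 131–132.
-/

universe u

open CategoryTheory CategoryTheory.Limits AlgebraicGeometry MonoidalCategory CartesianMonoidalCategory

noncomputable section

namespace Literature.AlgebraicGeometry.Motives

open scoped MonObj
open RatFn

namespace AbelianVariety

variable {K : Type u} [Field K] {A B : AbelianVariety K} (f : A ⟶ B)

/-! ### A homomorphism commutes with `[n]` and intertwines translations -/

/-- The underlying scheme morphism of a composite is the composite of the underlying scheme
morphisms. [folklore] -/
private theorem toSchemeHom_comp_eq {C : AbelianVariety K} (g : B ⟶ C) :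
    Hom.toSchemeHom (f ≫ g) = Hom.toSchemeHom f ≫ Hom.toSchemeHom g := rfl

/-- **`f ≫ [n]_B = [n]_A ≫ f`** on underlying schemes: a homomorphism commutes with multiplication by
`n` (bilinearity of composition, Mumford §19). [cite: MumfordAV1970, §19 (first paragraph)] -/
theorem toSchemeHom_comp_zsmul (n : ℤ) :
    Hom.toSchemeHom f ≫ Hom.toSchemeHom (n • 𝟙 B) = Hom.toSchemeHom (n • 𝟙 A) ≫ Hom.toSchemeHom f := by
  rw [← toSchemeHom_comp_eq, ← toSchemeHom_comp_eq, Preadditive.comp_zsmul, Preadditive.zsmul_comp,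
    Category.comp_id, Category.id_comp]

/-- **`t_P ≫ f = f ≫ t_{f P}`**: a homomorphism of abelian varieties intertwines the translation by a
rational point `P` with the translation by its image `f P = P ≫ f` (on `T`-points:
`f(P · x) = f(P) · f(x)`; Mumford §4). [cite: MumfordAV1970, §4 (Cor. 1 of the rigidity lemma)] -/
theorem translation_comp_hom_eq (P : A.Points K) :
    A.translation P ≫ f.hom.hom.hom = f.hom.hom.hom ≫ B.translation (AlgPoints.map f.hom.hom.hom P) := by
  unfold translation AlgPoints.map
  rw [MonObj.mul_comp, Category.id_comp, MonObj.comp_mul, Category.comp_id, Category.assoc,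
    ← Category.assoc f.hom.hom.hom (toSpecOver B.X), comp_toSpecOver_eq']

/-- `t_P ≫ f = f ≫ t_{f P}` on underlying scheme morphisms. [cite: MumfordAV1970, §4 (Cor. 1 of the rigidity lemma)] -/
theorem translation_left_comp_toSchemeHom (P : A.Points K) :
    (A.translation P).left ≫ Hom.toSchemeHom f =
      Hom.toSchemeHom f ≫ (B.translation (AlgPoints.map f.hom.hom.hom P)).left :=
  congrArg CommaMorphism.left (translation_comp_hom_eq f P)

/-- **`f(A[n](K)) ⊆ B[n](K)`**: a homomorphism maps `n`-torsion points to `n`-torsion points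
(`(P ≫ f)^n = P^n ≫ f`, Mathlib `GrpObj.zpow_comp`). [cite: MumfordAV1970, §4 (Cor. 1 of the rigidity lemma)] -/
theorem map_mem_torsionPoints {n : ℤ} {P : A.Points K} (hP : P ∈ A.torsionPoints K n) :
    AlgPoints.map f.hom.hom.hom P ∈ B.torsionPoints K n := by
  rw [mem_torsionPoints_iff] at hP ⊢
  unfold AlgPoints.map
  rw [← GrpObj.zpow_comp, hP, MonObj.one_comp]

/-! ### `D_Q(f^*Θ) = f^* D_{fQ}(Θ)` and transport of trivializers -/

section Dominant

variable [IsDominant (Hom.toSchemeHom f)]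

/-- **`D_Q(f^*Θ) = f^*(D_{f Q}(Θ))` as divisors**: `t_Q^* f^*Θ − f^*Θ = (t_Q ≫ f)^*Θ − f^*Θ =
(f ≫ t_{fQ})^*Θ − f^*Θ = f^*(t_{fQ}^*Θ − Θ)` (same local equations on the same opens).
[cite: MumfordAV1970, §20 (property (3) of e_n, p. 186)] -/
theorem weilDiv_pullback_sameDivisor (Θ : CartierDivisor B.X.left) (Q : A.Points K) :
    (A.weilDiv (Θ.pullback (Hom.toSchemeHom f)) Q).SameDivisor
      ((B.weilDiv Θ (AlgPoints.map f.hom.hom.hom Q)).pullback (Hom.toSchemeHom f)) := by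
  have ht := translation_left_comp_toSchemeHom f Q
  haveI : IsDominant ((A.translation Q).left ≫ Hom.toSchemeHom f) := inferInstance
  haveI : IsDominant (Hom.toSchemeHom f ≫ (B.translation (AlgPoints.map f.hom.hom.hom Q)).left) :=
    inferInstance
  -- `t_Q^* f^* Θ ~ (t_Q ≫ f)^* Θ = (f ≫ t_{fQ})^* Θ ~ f^* t_{fQ}^* Θ`
  have h1 : ((Θ.pullback (Hom.toSchemeHom f)).pullback (A.translation Q).left).SameDivisor
      ((Θ.pullback (B.translation (AlgPoints.map f.hom.hom.hom Q)).left).pullback (Hom.toSchemeHom f)) :=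
    ((Θ.pullback_pullback_sameDivisor _ _).trans (Θ.pullback_congr_sameDivisor ht)).trans
      (Θ.pullback_pullback_sameDivisor _ _).symm
  -- `-(f^* Θ) ~ f^* (-Θ)`
  have h2 : (-(Θ.pullback (Hom.toSchemeHom f))).SameDivisor ((-Θ).pullback (Hom.toSchemeHom f)) :=
    (CartierDivisor.pullback_neg_sameDivisor _ Θ).symm
  exact (h1.add h2).trans (CartierDivisor.pullback_add_sameDivisor _ _ _).symm

variable {N : ℕ} [IsDominant (Hom.toSchemeHom ((N : ℤ) • 𝟙 A))] [IsDominant (Hom.toSchemeHom ((N : ℤ) • 𝟙 B))]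

/-- **`f^♯ g` trivializes `[N]_A^* f^* E` if `g` trivializes `[N]_B^* E`** (`f` commutes with `[N]`;
the units `[N]^♯ e_i · g` at `f x` pull back to units at `x`). [cite: Lang1983AbelianVarieties, Ch. VII §2 Prop. 3] -/
theorem IsTrivializer.comp_hom {E : CartierDivisor B.X.left} {g : B.X.left.functionField}
    (hg : B.IsTrivializer (n := N) E g) :
    A.IsTrivializer (n := N) (E.pullback (Hom.toSchemeHom f)) (functionFieldMap (Hom.toSchemeHom f) g) := by
  refine ⟨(map_ne_zero _).2 hg.1, fun i x hi => ?_⟩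
  have hcomm := toSchemeHom_comp_zsmul f (N : ℤ)
  have hi' : Hom.toSchemeHom ((N : ℤ) • 𝟙 B) ((Hom.toSchemeHom f) x) ∈ E.U i := by
    rw [← Scheme.Hom.comp_apply, hcomm, Scheme.Hom.comp_apply]
    exact hi
  have h1 : IsUnitAt x (functionFieldMap (Hom.toSchemeHom f)
      (functionFieldMap (Hom.toSchemeHom ((N : ℤ) • 𝟙 B)) (E.f i) * g)) :=
    (hg.2 i _ hi').functionFieldMap
  rw [map_mul] at h1
  haveI : IsDominant (Hom.toSchemeHom f ≫ Hom.toSchemeHom ((N : ℤ) • 𝟙 B)) := inferInstance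
  haveI : IsDominant (Hom.toSchemeHom ((N : ℤ) • 𝟙 A) ≫ Hom.toSchemeHom f) := inferInstance
  have h2 := functionFieldMap_comp (Hom.toSchemeHom ((N : ℤ) • 𝟙 B)) (Hom.toSchemeHom f)
  have h3 := functionFieldMap_comp (Hom.toSchemeHom f) (Hom.toSchemeHom ((N : ℤ) • 𝟙 A))
  have h4 : functionFieldMap (Hom.toSchemeHom f ≫ Hom.toSchemeHom ((N : ℤ) • 𝟙 B)) =
      functionFieldMap (Hom.toSchemeHom ((N : ℤ) • 𝟙 A) ≫ Hom.toSchemeHom f) :=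
    functionFieldMap_congr hcomm
  rw [h2, h3] at h4
  have h5 := congrArg (fun φ => φ (E.f i)) h4
  simp only [RingHom.coe_comp, Function.comp_apply] at h5
  convert h1 using 2
  rw [CartierDivisor.pullback_f]
  exact h5.symm

/-! ### `ē_N^{f^*Θ}(P, Q) = ē_N^Θ(f P, f Q)` -/

/-- **Functoriality of the level Weil pairing under a dominant homomorphism** `f : A → B`: for a
Cartier divisor `Θ` on `B`, `P, Q ∈ A[N](K)` and `N`-torsion points `P', Q'` of `B` with
`P' = f P`, `Q' = f Q`: `ē_N^{f^*Θ}(P, Q) = ē_N^Θ(P', Q')`.  Mumford §20 (3)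
«`e_n(f(x), ŷ) = e_n(x, f̂(ŷ))`» with `φ_{f^*L} = f̂ φ_L f`; Lang VII §2 Prop. 2 (iii)/Thm. 5.
Proof: `f^♯ g_{Q'}` trivializes `[N]^* D_Q(f^*Θ) = f^*[N]^* D_{Q'}`, and
`t_P^♯ f^♯ g / f^♯ g = f^♯(t_{P'}^♯ g / g) = f^♯ ē(P', Q') = ē(P', Q')`. [cite: MumfordAV1970, §20 (property (3) of e_n, p. 186)] -/
theorem weilPairingLevel_pullback_eq (Θ : CartierDivisor B.X.left) (P Q : A.torsionPoints K N)
    (P' Q' : B.torsionPoints K N) (hP : (P' : B.Points K) = AlgPoints.map f.hom.hom.hom P)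
    (hQ : (Q' : B.Points K) = AlgPoints.map f.hom.hom.hom Q) :
    A.weilPairingLevel (Θ.pullback (Hom.toSchemeHom f)) P Q = B.weilPairingLevel Θ P' Q' := by
  obtain ⟨P'₀, hP'₀⟩ := P'
  obtain ⟨Q'₀, hQ'₀⟩ := Q'
  subst hP hQ
  -- the trivializer `g = g_{fQ}` of `[N]^* D_{fQ}` and its transport `f^♯ g`
  have hg : B.IsTrivializer (n := N) (B.weilDiv Θ (AlgPoints.map f.hom.hom.hom Q.1))
      (B.weilFn Θ ⟨AlgPoints.map f.hom.hom.hom Q.1, hQ'₀⟩) :=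
    B.isTrivializer_weilFn Θ ⟨AlgPoints.map f.hom.hom.hom Q.1, hQ'₀⟩
  have hg' : A.IsTrivializer (n := N) (A.weilDiv (Θ.pullback (Hom.toSchemeHom f)) Q.1)
      (functionFieldMap (Hom.toSchemeHom f) (B.weilFn Θ ⟨AlgPoints.map f.hom.hom.hom Q.1, hQ'₀⟩)) :=
    (hg.comp_hom f).of_sameDivisor (weilDiv_pullback_sameDivisor f Θ Q.1).symm
  rw [weilPairingLevel_eq_kummerConst (Q := Q) hg' P]
  apply (algebraMap K A.X.left.functionField).injective
  rw [algebraMap_kummerConst]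
  -- `t_P^♯ ∘ f^♯ = f^♯ ∘ t_{fP}^♯`
  have ht := translation_left_comp_toSchemeHom f P.1
  haveI : IsDominant ((A.translation P.1).left ≫ Hom.toSchemeHom f) := inferInstance
  haveI : IsDominant (Hom.toSchemeHom f ≫ (B.translation (AlgPoints.map f.hom.hom.hom P.1)).left) :=
    inferInstance
  have hFF : (functionFieldMap (A.translation P.1).left).comp (functionFieldMap (Hom.toSchemeHom f)) =
      (functionFieldMap (Hom.toSchemeHom f)).comp
        (functionFieldMap (B.translation (AlgPoints.map f.hom.hom.hom P.1)).left) := by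
    have h := functionFieldMap_congr ht
    rw [functionFieldMap_comp, functionFieldMap_comp] at h
    exact h
  change functionFieldMap (A.translation P.1).left
      (functionFieldMap (Hom.toSchemeHom f) (B.weilFn Θ ⟨AlgPoints.map f.hom.hom.hom Q.1, hQ'₀⟩)) /
      functionFieldMap (Hom.toSchemeHom f) (B.weilFn Θ ⟨AlgPoints.map f.hom.hom.hom Q.1, hQ'₀⟩) = _
  rw [← RingHom.comp_apply (functionFieldMap (A.translation P.1).left), hFF, RingHom.comp_apply,
    ← map_div₀]
  change functionFieldMap (Hom.toSchemeHom f)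
      (B.translFF (AlgPoints.map f.hom.hom.hom P.1) (B.weilFn Θ ⟨AlgPoints.map f.hom.hom.hom Q.1, hQ'₀⟩) /
        B.weilFn Θ ⟨AlgPoints.map f.hom.hom.hom Q.1, hQ'₀⟩) = _
  rw [← algebraMap_kummerConst hg ⟨AlgPoints.map f.hom.hom.hom P.1, map_mem_torsionPoints f P.2⟩,
    functionFieldMap_toSchemeHom_algebraMap]
  rfl

/-- **`ē_N^{f^*Θ}(P, Q) = ē_N^Θ(f P, f Q)`** with the images `f P`, `f Q` as the `N`-torsion points
`⟨P ≫ f, map_mem_torsionPoints⟩` of `B`. [cite: MumfordAV1970, §20 (property (3) of e_n, p. 186)] -/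
theorem weilPairingLevel_pullback (Θ : CartierDivisor B.X.left) (P Q : A.torsionPoints K N) :
    A.weilPairingLevel (Θ.pullback (Hom.toSchemeHom f)) P Q =
      B.weilPairingLevel Θ ⟨AlgPoints.map f.hom.hom.hom P.1, map_mem_torsionPoints f P.2⟩
        ⟨AlgPoints.map f.hom.hom.hom Q.1, map_mem_torsionPoints f Q.2⟩ :=
  weilPairingLevel_pullback_eq f Θ P Q _ _ rfl rfl

/-- The same for a divisor `Θ'` on `A` that is merely the SAME DIVISOR as `f^*Θ` (e.g. obtained from
`f^*Θ` by re-indexing or refining the presentation): `ē_N^{Θ'}(P, Q) = ē_N^Θ(f P, f Q)`.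
[cite: MumfordAV1970, §20 (property (3) of e_n, p. 186)] -/
theorem weilPairingLevel_eq_of_sameDivisor_pullback {Θ' : CartierDivisor A.X.left} (Θ : CartierDivisor B.X.left)
    (hΘ : Θ'.SameDivisor (Θ.pullback (Hom.toSchemeHom f))) (P Q : A.torsionPoints K N) :
    A.weilPairingLevel Θ' P Q =
      B.weilPairingLevel Θ ⟨AlgPoints.map f.hom.hom.hom P.1, map_mem_torsionPoints f P.2⟩
        ⟨AlgPoints.map f.hom.hom.hom Q.1, map_mem_torsionPoints f Q.2⟩ := by
  rw [← weilPairingLevel_pullback f Θ P Q]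
  -- `D_Q(Θ') ~ D_Q(f^*Θ)`: same trivializer, same constant
  have hg' : A.IsTrivializer (n := N) (A.weilDiv (Θ.pullback (Hom.toSchemeHom f)) Q.1)
      (A.weilFn (Θ.pullback (Hom.toSchemeHom f)) Q) :=
    A.isTrivializer_weilFn (Θ.pullback (Hom.toSchemeHom f)) Q
  have hD : (A.weilDiv (Θ.pullback (Hom.toSchemeHom f)) Q.1).SameDivisor (A.weilDiv Θ' Q.1) :=
    ((hΘ.pullback _).add hΘ.neg).symm
  rw [weilPairingLevel_eq_kummerConst (Q := Q) (hg'.of_sameDivisor hD) P]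
  rfl

end Dominant

end AbelianVariety

end Literature.AlgebraicGeometry.Motives

end
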